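import Literature.NumberTheory.GaloisCohomology.Howard2004.SelmerTriples
import Literature.NumberTheory.GaloisRepresentations.ContinuousCupProductCompatMixed
import Literature.NumberTheory.GaloisRepresentations.BlochKatoSelmerGroup
import HarnessLib

/-!
# Naturality of Howard's induced local pairing `localCup` in the duality datum: reduction compatibility (hB) and
# the projection formula (Adj), (Adj′) (proofs)

`Proofs` file (theorems only; no definition, no named fact, no instance) in the currency of the cell's typing of
B. Howard, *The Heegner point Kolyvagin system*, Compositio Math. 140 (2004), §1.3 (`SelmerTriples.lean`:
`DualityDatum`, `DualityDatum.localCup : H¹(K_v, T) × H¹(K_v, Tw T) → H²(K_v, R(1))`).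

For two duality data `D₁` on `(T₁, R₁)` and `D₂` on `(T₂, R₂)` over the same conjugation datum `cd` (two levels
`T^{(k+1)}, T^{(k)}` of a tower, §1.6), an equivariant additive `r : T₁ → T₂` and an additive `φ : R₁ → R₂` intertwining
the Tate twists `R₁(1) → R₂(1)`:

* **(hB) `DualityDatum.localCup_map`** — if `φ (e₁(s, t)) = e₂(r s, r t)` (the `e_red` clause of the cell's
  `DVRSetting.SatisfiesH`) then `H²(φ) (x ∪₁ y) = H¹(r) x ∪₂ H¹(r) y` (tree `ContPairing.cupProduct_map`): the level
  pairings are compatible with the reductions — hypothesis `hB` of the saturated-annihilator descent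
  `Tower.levelCondition_mem_iff_forall_pairing_eq_zero[_of_forall_nsmul_eq_zero]`;
* **(Adj) `DualityDatum.localCup_map_adjoint`** — for `u : T₂ → T₁` equivariant with `φ (e₁(u s, t)) = e₂(s, r t)`
  (e.g. `u = ×p^d : T/p^k ↪ T/p^{k+d}` against the reduction `r`, with `φ = ×p^d` on the values):
  `H²(φ) (H¹(u) x ∪₁ y) = x ∪₂ H¹(r) y` (tree `ContPairing.cupProduct_map_adjoint`) — hypothesis (Adj) of
  `Tower.mem_levelCondition_top_of_forall_pairing_bot_eq_zero`;
* **(Adj′) `DualityDatum.localCup_map_adjoint'`** (appended) — the mirror variance, literally the shape of that lemma's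
  `hAdj : incQ d (B k x (redIter red' k d w)) = B (k + d) (up d x) w`: for `u : T₁ → T₂`, `r : T₂ → T₁` equivariant with
  `φ (e₁(s, r t)) = e₂(u s, t)`, `H²(φ) (x ∪₁ H¹(r) w) = H¹(u) x ∪₂ w` (tree `ContPairing.cupProduct_map_adjoint'`).

All cohomology maps are in the `ContinuousRep.cohomologyMap … (toLocal v) …` currency of `DVRSetting.cond_red`.  Cell
`pub/bsd-print-x9` (Howard H.4 at the places `v ∣ N` of the Eisenstein setting); nothing arithmetic is proved here; BSD is
not proved by any of this.

References: [Howard2004HeegnerKolyvagin] §1.3 H.4 (arXiv:1202.6340 p. 7, L69–82), §1.6 (p. 11, L33–38: the tower and its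
pairings); [NeukirchSchmidtWingberg2008] I §4 (1.4.2) (naturality of the cup product); [MilneADT2006] I Cor. 2.3.
-/

set_option autoImplicit false

noncomputable section

open Function NumberField IsDedekindDomain Field CategoryTheory
open scoped NumberField ContRepresentation

namespace Literature.NumberTheory.GaloisCohomology.Howard2004

open Literature.NumberTheory.GaloisRepresentations
open Literature.NumberTheory.GaloisRepresentations.DiscreteGaloisModule

variable {K : Type} [Field K] [NumberField K]
  {M₁ : Type} [AddCommGroup M₁] [TopologicalSpace M₁] [DiscreteTopology M₁]
  {M₂ : Type} [AddCommGroup M₂] [TopologicalSpace M₂] [DiscreteTopology M₂]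
  {R₁ : Type} [CommRing R₁] [Module R₁ M₁] [TopologicalSpace R₁] [DiscreteTopology R₁]
  {R₂ : Type} [CommRing R₂] [Module R₂ M₂] [TopologicalSpace R₂] [DiscreteTopology R₂]
  {p : ℕ} [Fact p.Prime] [Algebra ℤ_[p] R₁] [Algebra ℤ_[p] R₂] {cd : ConjugationDatum K}
  {ρ₁ : DiscreteGaloisModule K M₁} {ρ₂ : DiscreteGaloisModule K M₂}

namespace DualityDatum

/-- **(hB) The induced local pairings are compatible with reduction.**  For duality data `D₁`, `D₂` over the same
conjugation datum, an equivariant `r : T₁ → T₂` and an additive `φ : R₁(1) → R₂(1)` intertwining the twists with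
`φ (e₁(s,t)) = e₂(r s, r t)`: `H²(φ)(x ∪₁ y) = H¹(r) x ∪₂ H¹(r) y` at every place `v`.
[cite: Howard2004HeegnerKolyvagin, §1.6 (arXiv p. 11, L33–38) and H.4 (p. 7, L78–82)]
[cite: NeukirchSchmidtWingberg2008, I §4 (1.4.2)] -/
theorem localCup_map (D₁ : DualityDatum p cd ρ₁ R₁) (D₂ : DualityDatum p cd ρ₂ R₂) (r : M₁ →+ M₂)
    (hr : ∀ (g : absoluteGaloisGroup K) (m : M₁), r (ρ₁ g m) = ρ₂ g (r m)) (φ : R₁ →+ R₂)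
    (hφ : ∀ (g : absoluteGaloisGroup K) (x : R₁), φ (D₁.twistOne g x) = D₂.twistOne g (φ x))
    (he : ∀ s t : M₁, φ (D₁.e s t) = D₂.e (r s) (r t)) (v : Place K)
    (x : galoisCohomology (ρ₁.toLocal v) 1) (y : galoisCohomology ((cd.twist ρ₁).toLocal v) 1) :
    ContinuousRep.cohomologyMap (D₁.twistOne.toLocal v) (D₂.twistOne.toLocal v) φ continuous_of_discreteTopology
        (fun _ z => hφ _ z) 2 (D₁.localCup v x y) =
      D₂.localCup v
        (ContinuousRep.cohomologyMap (ρ₁.toLocal v) (ρ₂.toLocal v) r continuous_of_discreteTopology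
          (fun _ m => hr _ m) 1 x)
        (ContinuousRep.cohomologyMap ((cd.twist ρ₁).toLocal v) ((cd.twist ρ₂).toLocal v) r
          continuous_of_discreteTopology (fun _ m => hr _ m) 1 y) := by
  haveI : CompactSpace (absoluteGaloisGroup (Place.Completion v)) := absoluteGaloisGroup_compactSpace _
  let α : (ρ₁.toLocal v).toTopRep ⟶ (ρ₂.toLocal v).toTopRep :=
    TopRep.ofHom ⟨⟨r.toIntLinearMap, continuous_of_discreteTopology⟩,
      fun _ => ContinuousLinearMap.ext fun m => hr _ m⟩
  let β : ((cd.twist ρ₁).toLocal v).toTopRep ⟶ ((cd.twist ρ₂).toLocal v).toTopRep :=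
    TopRep.ofHom ⟨⟨r.toIntLinearMap, continuous_of_discreteTopology⟩,
      fun _ => ContinuousLinearMap.ext fun m => hr _ m⟩
  let γ : (D₁.twistOne.toLocal v).toTopRep ⟶ (D₂.twistOne.toLocal v).toTopRep :=
    TopRep.ofHom ⟨⟨φ.toIntLinearMap, continuous_of_discreteTopology⟩,
      fun _ => ContinuousLinearMap.ext fun z => hφ _ z⟩
  have h := ContPairing.cupProduct_map (D₁.ePairingLocal v) (D₂.ePairingLocal v) α β γ (fun s t => he s t) x y
  exact h

/-- **(Adj) The projection formula for the induced local pairings.**  For duality data `D₁`, `D₂` over the same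
conjugation datum, equivariant `u : T₂ → T₁` (left), `r : T₁ → T₂` (right) and `φ : R₁(1) → R₂(1)` intertwining the
twists with `φ (e₁(u s, t)) = e₂(s, r t)`: `H²(φ)(H¹(u) x ∪₁ y) = x ∪₂ H¹(r) y` at every place `v`.
[cite: Howard2004HeegnerKolyvagin, §1.6 (arXiv p. 11, L33–38) and H.4 (p. 7, L78–82)]
[cite: NeukirchSchmidtWingberg2008, I §4 (1.4.2)] -/
theorem localCup_map_adjoint (D₁ : DualityDatum p cd ρ₁ R₁) (D₂ : DualityDatum p cd ρ₂ R₂) (u : M₂ →+ M₁)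
    (hu : ∀ (g : absoluteGaloisGroup K) (m : M₂), u (ρ₂ g m) = ρ₁ g (u m)) (r : M₁ →+ M₂)
    (hr : ∀ (g : absoluteGaloisGroup K) (m : M₁), r (ρ₁ g m) = ρ₂ g (r m)) (φ : R₁ →+ R₂)
    (hφ : ∀ (g : absoluteGaloisGroup K) (x : R₁), φ (D₁.twistOne g x) = D₂.twistOne g (φ x))
    (he : ∀ (s : M₂) (t : M₁), φ (D₁.e (u s) t) = D₂.e s (r t)) (v : Place K)
    (x : galoisCohomology (ρ₂.toLocal v) 1) (y : galoisCohomology ((cd.twist ρ₁).toLocal v) 1) :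
    ContinuousRep.cohomologyMap (D₁.twistOne.toLocal v) (D₂.twistOne.toLocal v) φ continuous_of_discreteTopology
        (fun _ z => hφ _ z) 2
        (D₁.localCup v
          (ContinuousRep.cohomologyMap (ρ₂.toLocal v) (ρ₁.toLocal v) u continuous_of_discreteTopology
            (fun _ m => hu _ m) 1 x) y) =
      D₂.localCup v x
        (ContinuousRep.cohomologyMap ((cd.twist ρ₁).toLocal v) ((cd.twist ρ₂).toLocal v) r
          continuous_of_discreteTopology (fun _ m => hr _ m) 1 y) := by
  haveI : CompactSpace (absoluteGaloisGroup (Place.Completion v)) := absoluteGaloisGroup_compactSpace _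
  let α : (ρ₂.toLocal v).toTopRep ⟶ (ρ₁.toLocal v).toTopRep :=
    TopRep.ofHom ⟨⟨u.toIntLinearMap, continuous_of_discreteTopology⟩,
      fun _ => ContinuousLinearMap.ext fun m => hu _ m⟩
  let β : ((cd.twist ρ₁).toLocal v).toTopRep ⟶ ((cd.twist ρ₂).toLocal v).toTopRep :=
    TopRep.ofHom ⟨⟨r.toIntLinearMap, continuous_of_discreteTopology⟩,
      fun _ => ContinuousLinearMap.ext fun m => hr _ m⟩
  let γ : (D₁.twistOne.toLocal v).toTopRep ⟶ (D₂.twistOne.toLocal v).toTopRep :=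
    TopRep.ofHom ⟨⟨φ.toIntLinearMap, continuous_of_discreteTopology⟩,
      fun _ => ContinuousLinearMap.ext fun z => hφ _ z⟩
  have h := ContPairing.cupProduct_map_adjoint (D₁.ePairingLocal v) (D₂.ePairingLocal v) α β γ
    (fun s t => he s t) x y
  exact h

/-- The intertwining hypothesis `hφ` for a `ℤ_p`-ALGEBRA map `φ : R₁ → R₂` (e.g. the reduction `A_{m,k+1} → A_{m,k}`):
`φ (χ(g) · x) = χ(g) · φ x` by `twistOne_apply`. [cite: Howard2004HeegnerKolyvagin, H.4 (arXiv p. 7, L69–73: R(1))] -/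
theorem twistOne_map_algHom (D₁ : DualityDatum p cd ρ₁ R₁) (D₂ : DualityDatum p cd ρ₂ R₂) (φ : R₁ →ₐ[ℤ_[p]] R₂)
    (g : absoluteGaloisGroup K) (x : R₁) :
    φ (D₁.twistOne g x) = D₂.twistOne g (φ x) := by
  rw [D₁.twistOne_apply, D₂.twistOne_apply, map_mul, AlgHom.commutes]

/-- **(Adj′) The projection formula, mirror variance** (the shape of the descent's `hAdj`:
`incQ (x ∪_k red'^{(d)} w) = up x ∪_{k+d} w`).  For duality data `D₁`, `D₂` over the same conjugation datum, equivariant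
`u : T₁ → T₂` (left, e.g. the inclusion `T^{(k)} ↪ T^{(k+d)}`), `r : T₂ → T₁` (right, e.g. the reduction) and
`φ : R₁(1) → R₂(1)` intertwining the twists with `φ (e₁(s, r t)) = e₂(u s, t)`:
`H²(φ)(x ∪₁ H¹(r) w) = H¹(u) x ∪₂ w` at every place `v` (tree `ContPairing.cupProduct_map_adjoint'`).
[cite: Howard2004HeegnerKolyvagin, §1.6 (arXiv p. 11, L33–38) and H.4 (p. 7, L78–82)]
[cite: NeukirchSchmidtWingberg2008, I §4 (1.4.2)] -/
theorem localCup_map_adjoint' (D₁ : DualityDatum p cd ρ₁ R₁) (D₂ : DualityDatum p cd ρ₂ R₂) (u : M₁ →+ M₂)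
    (hu : ∀ (g : absoluteGaloisGroup K) (m : M₁), u (ρ₁ g m) = ρ₂ g (u m)) (r : M₂ →+ M₁)
    (hr : ∀ (g : absoluteGaloisGroup K) (m : M₂), r (ρ₂ g m) = ρ₁ g (r m)) (φ : R₁ →+ R₂)
    (hφ : ∀ (g : absoluteGaloisGroup K) (x : R₁), φ (D₁.twistOne g x) = D₂.twistOne g (φ x))
    (he : ∀ (s : M₁) (t : M₂), φ (D₁.e s (r t)) = D₂.e (u s) t) (v : Place K)
    (x : galoisCohomology (ρ₁.toLocal v) 1) (w : galoisCohomology ((cd.twist ρ₂).toLocal v) 1) :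
    ContinuousRep.cohomologyMap (D₁.twistOne.toLocal v) (D₂.twistOne.toLocal v) φ continuous_of_discreteTopology
        (fun _ z => hφ _ z) 2
        (D₁.localCup v x
          (ContinuousRep.cohomologyMap ((cd.twist ρ₂).toLocal v) ((cd.twist ρ₁).toLocal v) r
            continuous_of_discreteTopology (fun _ m => hr _ m) 1 w)) =
      D₂.localCup v
        (ContinuousRep.cohomologyMap (ρ₁.toLocal v) (ρ₂.toLocal v) u continuous_of_discreteTopology
          (fun _ m => hu _ m) 1 x) w := by
  haveI : CompactSpace (absoluteGaloisGroup (Place.Completion v)) := absoluteGaloisGroup_compactSpace _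
  let α : (ρ₁.toLocal v).toTopRep ⟶ (ρ₂.toLocal v).toTopRep :=
    TopRep.ofHom ⟨⟨u.toIntLinearMap, continuous_of_discreteTopology⟩,
      fun _ => ContinuousLinearMap.ext fun m => hu _ m⟩
  let β : ((cd.twist ρ₂).toLocal v).toTopRep ⟶ ((cd.twist ρ₁).toLocal v).toTopRep :=
    TopRep.ofHom ⟨⟨r.toIntLinearMap, continuous_of_discreteTopology⟩,
      fun _ => ContinuousLinearMap.ext fun m => hr _ m⟩
  let γ : (D₁.twistOne.toLocal v).toTopRep ⟶ (D₂.twistOne.toLocal v).toTopRep :=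
    TopRep.ofHom ⟨⟨φ.toIntLinearMap, continuous_of_discreteTopology⟩,
      fun _ => ContinuousLinearMap.ext fun z => hφ _ z⟩
  have h := ContPairing.cupProduct_map_adjoint' (D₁.ePairingLocal v) (D₂.ePairingLocal v) α β γ
    (fun s t => he s t) x w
  exact h

end DualityDatum

end Literature.NumberTheory.GaloisCohomology.Howard2004

end
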